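import Summits.ValiantsHypothesis.ValiantsHypothesis.Theorems.RigidityForcesSymmetryRankRigidMinimalReprLaplaceDefs

/-!
# The DETERMINANT pattern is Laplace-cheap: `D₄` in 3 terms (weight 12 < 24), `D₅` in 5 terms (weight 72 < 120)
# (Negative lane of stmt-ValiantsHypothesis-24813 `LaplaceOptimalFive`; val-neg-2 g2, refuter; director-valiant b126 (2) check (iii))

`LaplaceOptimal d` (`…RankRigidMinimalReprLaplaceDefs`) says: every split-rank-one decomposition
`Σ_t u_t(v|_{S_t}) · w_t(v|_{S_tᶜ}) = [v injective]` of the PERMANENT pattern `P_d` on `Fin d → Fin d` has Laplace weight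
`Σ_t |S_t|! (d-|S_t|)! ≥ d!`.  This file records, kernel-checked, that the SIGNED pattern — the Levi-Civita symbol
`D_d(v) = sgn(v)·[v injective] = ∏_{i<j} sgn(v j - v i)` (the determinant in place of the permanent) — is CHEAP:

* `sign_four_pfaffian` : `D₄(a,b,c,d) = ω(a,b)ω(c,d) - ω(a,c)ω(b,d) + ω(a,d)ω(b,c)` on all of `Fin 4 → Fin 4`, where `ω` is the
  standard symplectic form on the letters (`ω(0,1) = ω(2,3) = 1`, `ω(1,0) = ω(3,2) = -1`, else `0`, Pfaffian `1`) — the identity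
  `ω ∧ ω = Pf(ω)·ε`.  THREE pair terms, one on each `2|2` split: Laplace weight `3·2!·2! = 12 < 24 = 4!`
  (`sign_four_cheap`, in the data format of `LaplaceOptimal 4`).
* `sign_five_hub_identity` : `D₅(a,b,c,d,e) = θ(a)·Ω(b,c,d,e) + ω(a,b)·(θ∧ω)(c,d,e) - ω(a,c)·(θ∧ω)(b,d,e) + ω(a,d)·(θ∧ω)(b,c,e)
  - ω(a,e)·(θ∧ω)(b,c,d)` on all of `Fin 5 → Fin 5`, with `θ = [· = 4]`, `Ω = ½ ω∧ω` (`Ω(b,c,d,e) = ω(b,c)ω(d,e) - ω(b,d)ω(c,e) +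
  ω(b,e)ω(c,d)`) and `(θ∧ω)(x,y,z) = θ(x)ω(y,z) - θ(y)ω(x,z) + θ(z)ω(x,y)` — the `5`-form `ε₅ = θ ∧ ½ω∧ω` expanded at the hub
  slot `0`.  ONE slice on slot `0` plus FOUR hub pair terms `01, 02, 03, 04`: Laplace weight `4! + 4·2!·3! = 72 < 120 = 5!`
  (`sign_five_cheap`, in the data format of `LaplaceOptimal 5`; `not_signLaplaceOptimal_five`, the signed analogue of
  `LaplaceOptimalFive` written out without new definitions, is FALSE).
* `levi_five_perm` / `levi_five_eq_zero` identify the inline product `∏_{i<j} sgn(v j - v i)` with `Equiv.Perm.sign` on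
  permutations and with `0` off them.

General `d` (not formalised here; verified by script at `d = 6`: five hub pair terms `2|4`, weight `240 < 720`):
`ε_{2m} = ω^m/m!` and `ε_{2m+1} = θ∧ω^m/m!` expanded at one slot give Laplace weight `2·(d-1)!` (even `d`) / `3·(d-1)!` (odd `d`),
a fraction `2/d`, `3/d` of `d!`.

STRUCTURE OF THE `d = 5` DESIGN (why it matters for 24813).  Integer entries `0, ±1`; the honest supports of the five terms TILE
`S₅` (24 permutations each); every term is «K1-avoiding» in the sense of the crux idea `twin-span-depth` (short contents `{0,1}`
or `{2,3}`, long contents `{0,1,4}` or `{2,3,4}`: letter blocks meet in `0` or `2` letters, never `1`) — there is NO depth-one cut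
junk; ALL junk lies on the `900` words of type `(2,2,1)` (the doubling stratum `Δ₅` of the crux idea `doubling-stratum-residue`)
and CANCELS there.  For the PERMANENT pattern the very same cells are infeasible (Levenberg–Marquardt floor `relres = 0.5448` at
`6/6` seeds, honest cells only and with all non-injective cells free; val-neg-2 g2 log `neg/g2/job24813`), and on the star profile
`3·01+2·02+2·03+2·04` (weight `108`) `D₅` is numerically EXACT (relres `1.5e-15`, bounded factors) where `P₅` is only BORDER
(`…LaplaceFiveBorder`, p629937).  CONSEQUENCE (a barrier, stated informally): every lower-bound technique for split decompositions
of `P₅` that applies verbatim to `D₅` — support / cover / tiling counts, letter-torus weights and their Newton polytopes, collision-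
depth bookkeeping, «exact off `Δ₅`» localisation, flattening ranks — proves at most weight `≥ 72`; a proof of `LaplaceOptimalFive`
(`≥ 120`) must use the SIGNS of the junk cancellation on `Δ₅`, i.e. must separate permanent from determinant at `d = 5`.

HONEST FRAMING: nothing here refutes or proves `LaplaceOptimalFive` (stmt-24813: `P₅`, not `D₅`), which stays OPEN; the crux
`RankRigidMinimalRepr` (18034) is untouched; `LaplaceOptimalFourFive` (27319) stays refuted and is not used; VP ≠ VNP is NOT proved.
-/

set_option autoImplicit false

-- the mandated summit-side namespace repeats a component by design (single-problem summit)
set_option linter.dupNamespace false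

namespace Summit.ValiantsHypothesis.ValiantsHypothesis.Theorems.LaplaceOptimalFiveNegative.SignPatternCheap


set_option maxHeartbeats 4000000 in
/-- **Pfaffian identity at `d = 4`.**  The Levi-Civita symbol `∏_{i<j} sgn(v j - v i)` on `Fin 4 → Fin 4` equals
`ω(a,b)ω(c,d) - ω(a,c)ω(b,d) + ω(a,d)ω(b,c)` for the standard symplectic `ω` (Pfaffian `1`): three pair terms, one per `2|2` split. -/
theorem sign_four_pfaffian : ∀ a b c d : Fin 4,
    ((if a < b then (1:ℤ) else if b < a then (-1:ℤ) else 0) * (if a < c then (1:ℤ) else if c < a then (-1:ℤ) else 0) * (if a < d then (1:ℤ) else if d < a then (-1:ℤ) else 0) * (if b < c then (1:ℤ) else if c < b then (-1:ℤ) else 0) * (if b < d then (1:ℤ) else if d < b then (-1:ℤ) else 0) * (if c < d then (1:ℤ) else if d < c then (-1:ℤ) else 0))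
      = (if a = 0 ∧ b = 1 then (1:ℤ) else if a = 1 ∧ b = 0 then (-1:ℤ) else if a = 2 ∧ b = 3 then (1:ℤ) else if a = 3 ∧ b = 2 then (-1:ℤ) else 0) * (if c = 0 ∧ d = 1 then (1:ℤ) else if c = 1 ∧ d = 0 then (-1:ℤ) else if c = 2 ∧ d = 3 then (1:ℤ) else if c = 3 ∧ d = 2 then (-1:ℤ) else 0)
        - (if a = 0 ∧ c = 1 then (1:ℤ) else if a = 1 ∧ c = 0 then (-1:ℤ) else if a = 2 ∧ c = 3 then (1:ℤ) else if a = 3 ∧ c = 2 then (-1:ℤ) else 0) * (if b = 0 ∧ d = 1 then (1:ℤ) else if b = 1 ∧ d = 0 then (-1:ℤ) else if b = 2 ∧ d = 3 then (1:ℤ) else if b = 3 ∧ d = 2 then (-1:ℤ) else 0)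
        + (if a = 0 ∧ d = 1 then (1:ℤ) else if a = 1 ∧ d = 0 then (-1:ℤ) else if a = 2 ∧ d = 3 then (1:ℤ) else if a = 3 ∧ d = 2 then (-1:ℤ) else 0) * (if b = 0 ∧ c = 1 then (1:ℤ) else if b = 1 ∧ c = 0 then (-1:ℤ) else if b = 2 ∧ c = 3 then (1:ℤ) else if b = 3 ∧ c = 2 then (-1:ℤ) else 0) := by
  decide

set_option maxHeartbeats 40000000 in
/-- **Hub identity at `d = 5`** (`ε₅ = θ ∧ ½ω∧ω` expanded at slot `0`).  The Levi-Civita symbol on `Fin 5 → Fin 5` equals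
`θ(a)Ω(b,c,d,e) + ω(a,b)(θ∧ω)(c,d,e) - ω(a,c)(θ∧ω)(b,d,e) + ω(a,d)(θ∧ω)(b,c,e) - ω(a,e)(θ∧ω)(b,c,d)`:
one slice (slot `0`) and four hub pair terms (`01, 02, 03, 04`), kernel `decide` on all `5⁵` points. -/
theorem sign_five_hub_identity : ∀ a b c d e : Fin 5,
    ((if a < b then (1:ℤ) else if b < a then (-1:ℤ) else 0) * (if a < c then (1:ℤ) else if c < a then (-1:ℤ) else 0) * (if a < d then (1:ℤ) else if d < a then (-1:ℤ) else 0) * (if a < e then (1:ℤ) else if e < a then (-1:ℤ) else 0) * (if b < c then (1:ℤ) else if c < b then (-1:ℤ) else 0) * (if b < d then (1:ℤ) else if d < b then (-1:ℤ) else 0) * (if b < e then (1:ℤ) else if e < b then (-1:ℤ) else 0) * (if c < d then (1:ℤ) else if d < c then (-1:ℤ) else 0) * (if c < e then (1:ℤ) else if e < c then (-1:ℤ) else 0) * (if d < e then (1:ℤ) else if e < d then (-1:ℤ) else 0))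
      = (if a = 4 then (1:ℤ) else 0) * ((if b = 0 ∧ c = 1 then (1:ℤ) else if b = 1 ∧ c = 0 then (-1:ℤ) else if b = 2 ∧ c = 3 then (1:ℤ) else if b = 3 ∧ c = 2 then (-1:ℤ) else 0) * (if d = 0 ∧ e = 1 then (1:ℤ) else if d = 1 ∧ e = 0 then (-1:ℤ) else if d = 2 ∧ e = 3 then (1:ℤ) else if d = 3 ∧ e = 2 then (-1:ℤ) else 0) - (if b = 0 ∧ d = 1 then (1:ℤ) else if b = 1 ∧ d = 0 then (-1:ℤ) else if b = 2 ∧ d = 3 then (1:ℤ) else if b = 3 ∧ d = 2 then (-1:ℤ) else 0) * (if c = 0 ∧ e = 1 then (1:ℤ) else if c = 1 ∧ e = 0 then (-1:ℤ) else if c = 2 ∧ e = 3 then (1:ℤ) else if c = 3 ∧ e = 2 then (-1:ℤ) else 0) + (if b = 0 ∧ e = 1 then (1:ℤ) else if b = 1 ∧ e = 0 then (-1:ℤ) else if b = 2 ∧ e = 3 then (1:ℤ) else if b = 3 ∧ e = 2 then (-1:ℤ) else 0) * (if c = 0 ∧ d = 1 then (1:ℤ) else if c = 1 ∧ d = 0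 then (-1:ℤ) else if c = 2 ∧ d = 3 then (1:ℤ) else if c = 3 ∧ d = 2 then (-1:ℤ) else 0))
        + (if a = 0 ∧ b = 1 then (1:ℤ) else if a = 1 ∧ b = 0 then (-1:ℤ) else if a = 2 ∧ b = 3 then (1:ℤ) else if a = 3 ∧ b = 2 then (-1:ℤ) else 0) * ((if c = 4 then (1:ℤ) else 0) * (if d = 0 ∧ e = 1 then (1:ℤ) else if d = 1 ∧ e = 0 then (-1:ℤ) else if d = 2 ∧ e = 3 then (1:ℤ) else if d = 3 ∧ e = 2 then (-1:ℤ) else 0) - (if d = 4 then (1:ℤ) else 0) * (if c = 0 ∧ e = 1 then (1:ℤ) else if c = 1 ∧ e = 0 then (-1:ℤ) else if c = 2 ∧ e = 3 then (1:ℤ) else if c = 3 ∧ e = 2 then (-1:ℤ) else 0) + (if e = 4 then (1:ℤ) else 0) * (if c = 0 ∧ d = 1 then (1:ℤ) else if c = 1 ∧ d = 0 then (-1:ℤ) else if c = 2 ∧ d = 3 then (1:ℤ) else if c = 3 ∧ d = 2 then (-1:ℤ) else 0))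
        - (if a = 0 ∧ c = 1 then (1:ℤ) else if a = 1 ∧ c = 0 then (-1:ℤ) else if a = 2 ∧ c = 3 then (1:ℤ) else if a = 3 ∧ c = 2 then (-1:ℤ) else 0) * ((if b = 4 then (1:ℤ) else 0) * (if d = 0 ∧ e = 1 then (1:ℤ) else if d = 1 ∧ e = 0 then (-1:ℤ) else if d = 2 ∧ e = 3 then (1:ℤ) else if d = 3 ∧ e = 2 then (-1:ℤ) else 0) - (if d = 4 then (1:ℤ) else 0) * (if b = 0 ∧ e = 1 then (1:ℤ) else if b = 1 ∧ e = 0 then (-1:ℤ) else if b = 2 ∧ e = 3 then (1:ℤ) else if b = 3 ∧ e = 2 then (-1:ℤ) else 0) + (if e = 4 then (1:ℤ) else 0) * (if b = 0 ∧ d = 1 then (1:ℤ) else if b = 1 ∧ d = 0 then (-1:ℤ) else if b = 2 ∧ d = 3 then (1:ℤ) else if b = 3 ∧ d = 2 then (-1:ℤ) else 0))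
        + (if a = 0 ∧ d = 1 then (1:ℤ) else if a = 1 ∧ d = 0 then (-1:ℤ) else if a = 2 ∧ d = 3 then (1:ℤ) else if a = 3 ∧ d = 2 then (-1:ℤ) else 0) * ((if b = 4 then (1:ℤ) else 0) * (if c = 0 ∧ e = 1 then (1:ℤ) else if c = 1 ∧ e = 0 then (-1:ℤ) else if c = 2 ∧ e = 3 then (1:ℤ) else if c = 3 ∧ e = 2 then (-1:ℤ) else 0) - (if c = 4 then (1:ℤ) else 0) * (if b = 0 ∧ e = 1 then (1:ℤ) else if b = 1 ∧ e = 0 then (-1:ℤ) else if b = 2 ∧ e = 3 then (1:ℤ) else if b = 3 ∧ e = 2 then (-1:ℤ) else 0) + (if e = 4 then (1:ℤ) else 0) * (if b = 0 ∧ c = 1 then (1:ℤ) else if b = 1 ∧ c = 0 then (-1:ℤ) else if b = 2 ∧ c = 3 then (1:ℤ) else if b = 3 ∧ c = 2 then (-1:ℤ) else 0))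
        - (if a = 0 ∧ e = 1 then (1:ℤ) else if a = 1 ∧ e = 0 then (-1:ℤ) else if a = 2 ∧ e = 3 then (1:ℤ) else if a = 3 ∧ e = 2 then (-1:ℤ) else 0) * ((if b = 4 then (1:ℤ) else 0) * (if c = 0 ∧ d = 1 then (1:ℤ) else if c = 1 ∧ d = 0 then (-1:ℤ) else if c = 2 ∧ d = 3 then (1:ℤ) else if c = 3 ∧ d = 2 then (-1:ℤ) else 0) - (if c = 4 then (1:ℤ) else 0) * (if b = 0 ∧ d = 1 then (1:ℤ) else if b = 1 ∧ d = 0 then (-1:ℤ) else if b = 2 ∧ d = 3 then (1:ℤ) else if b = 3 ∧ d = 2 then (-1:ℤ) else 0) + (if d = 4 then (1:ℤ) else 0) * (if b = 0 ∧ c = 1 then (1:ℤ) else if b = 1 ∧ c = 0 then (-1:ℤ) else if b = 2 ∧ c = 3 then (1:ℤ) else if b = 3 ∧ c = 2 then (-1:ℤ) else 0)) := by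
  decide

set_option maxHeartbeats 40000000 in
/-- A tie among the letters kills the inline Levi-Civita product (kernel `decide`, curried letters). -/
theorem levi_five_eq_zero_of_eq : ∀ a b c d e : Fin 5,
    (a = b ∨ a = c ∨ a = d ∨ a = e ∨ b = c ∨ b = d ∨ b = e ∨ c = d ∨ c = e ∨ d = e) →
    ((if a < b then (1:ℤ) else if b < a then (-1:ℤ) else 0) * (if a < c then (1:ℤ) else if c < a then (-1:ℤ) else 0) * (if a < d then (1:ℤ) else if d < a then (-1:ℤ) else 0) * (if a < e then (1:ℤ) else if e < a then (-1:ℤ) else 0) * (if b < c then (1:ℤ) else if c < b then (-1:ℤ) else 0) * (if b < d then (1:ℤ) else if d < b then (-1:ℤ) else 0) * (if b < e then (1:ℤ) else if e < b then (-1:ℤ) else 0) * (if c < d then (1:ℤ) else if d < c then (-1:ℤ) else 0) * (if c < e then (1:ℤ) else if e < c then (-1:ℤ) else 0) * (if d < e then (1:ℤ) else if e < d then (-1:ℤ) else 0)) = 0 := by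
  decide

/-- Off the permutations the inline Levi-Civita product vanishes. -/
theorem levi_five_eq_zero (v : Fin 5 → Fin 5) (hv : ¬ Function.Injective v) :
    ((if v 0 < v 1 then (1:ℤ) else if v 1 < v 0 then (-1:ℤ) else 0) * (if v 0 < v 2 then (1:ℤ) else if v 2 < v 0 then (-1:ℤ) else 0) * (if v 0 < v 3 then (1:ℤ) else if v 3 < v 0 then (-1:ℤ) else 0) * (if v 0 < v 4 then (1:ℤ) else if v 4 < v 0 then (-1:ℤ) else 0) * (if v 1 < v 2 then (1:ℤ) else if v 2 < v 1 then (-1:ℤ) else 0) * (if v 1 < v 3 then (1:ℤ) else if v 3 < v 1 then (-1:ℤ) else 0) * (if v 1 < v 4 then (1:ℤ) else if v 4 < v 1 then (-1:ℤ) else 0) * (if v 2 < v 3 then (1:ℤ) else if v 3 < v 2 then (-1:ℤ) else 0) * (if v 2 < v 4 then (1:ℤ) else if v 4 < v 2 then (-1:ℤ) else 0) * (if v 3 < v 4 then (1:ℤ) else if v 4 < v 3 then (-1:ℤ) else 0)) = 0 := by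
  apply levi_five_eq_zero_of_eq
  by_contra h
  push Not at h
  obtain ⟨h01, h02, h03, h04, h12, h13, h14, h23, h24, h34⟩ := h
  apply hv
  intro i j hij
  fin_cases i <;> fin_cases j <;> first | rfl | (exfalso; simp_all)

/-- On permutations the inline Levi-Civita product IS the signature (`Equiv.Perm.sign_eq_prod_prod_Ioi`). -/
theorem levi_five_perm (σ : Equiv.Perm (Fin 5)) :
    ((if σ 0 < σ 1 then (1:ℤ) else if σ 1 < σ 0 then (-1:ℤ) else 0) * (if σ 0 < σ 2 then (1:ℤ) else if σ 2 < σ 0 then (-1:ℤ) else 0) * (if σ 0 < σ 3 then (1:ℤ) else if σ 3 < σ 0 then (-1:ℤ) else 0) * (if σ 0 < σ 4 then (1:ℤ) else if σ 4 < σ 0 then (-1:ℤ) else 0) * (if σ 1 < σ 2 then (1:ℤ) else if σ 2 < σ 1 then (-1:ℤ) else 0) * (if σ 1 < σ 3 then (1:ℤ) else if σ 3 < σ 1 then (-1:ℤ) else 0) * (if σ 1 < σ 4 then (1:ℤ) else if σ 4 < σ 1 then (-1:ℤ) else 0) * (if σ 2 < σ 3 then (1:ℤ) else if σ 3 < σ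 2 then (-1:ℤ) else 0) * (if σ 2 < σ 4 then (1:ℤ) else if σ 4 < σ 2 then (-1:ℤ) else 0) * (if σ 3 < σ 4 then (1:ℤ) else if σ 4 < σ 3 then (-1:ℤ) else 0)) = ((Equiv.Perm.sign σ : ℤˣ) : ℤ) := by
  have key : ∀ i j : Fin 5, i < j →
      (if σ i < σ j then (1:ℤ) else if σ j < σ i then (-1:ℤ) else 0) = (((if σ i < σ j then 1 else -1 : ℤˣ)) : ℤ) := by
    intro i j hij
    have hne : σ i ≠ σ j := fun h => (ne_of_lt hij) (σ.injective h)
    by_cases h : σ i < σ j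
    · simp [h]
    · have h' : σ j < σ i := lt_of_le_of_ne (not_lt.mp h) (Ne.symm hne)
      simp [h, h']
  have e0 : Finset.Ioi (0 : Fin 5) = {1, 2, 3, 4} := by decide
  have e1 : Finset.Ioi (1 : Fin 5) = {2, 3, 4} := by decide
  have e2 : Finset.Ioi (2 : Fin 5) = {3, 4} := by decide
  have e3 : Finset.Ioi (3 : Fin 5) = {4} := by decide
  have e4 : Finset.Ioi (4 : Fin 5) = ∅ := by decide
  rw [key 0 1 (by decide), key 0 2 (by decide), key 0 3 (by decide), key 0 4 (by decide), key 1 2 (by decide),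
    key 1 3 (by decide), key 1 4 (by decide), key 2 3 (by decide), key 2 4 (by decide), key 3 4 (by decide),
    Equiv.Perm.sign_eq_prod_prod_Ioi, Fin.prod_univ_five, e0, e1, e2, e3, e4]
  push_cast
  simp [Finset.prod_insert, mul_assoc]

set_option maxHeartbeats 40000000 in
/-- **A split decomposition of the determinant pattern `D₅` of Laplace weight `72 < 120`**, in the data format of
`LaplaceOptimal 5` (locality of the `u_t` / `w_t`, the weight, the identity on ALL of `Fin 5 → Fin 5` with target the Levi-Civita
symbol cast to `ℂ`): `S = ({0}, {0,1}, {0,2}, {0,3}, {0,4})`, `u = (θ(v0), ω(v0,v1), -ω(v0,v2), ω(v0,v3), -ω(v0,v4))`,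
`w = (Ω(v1,v2,v3,v4), (θ∧ω)(v2,v3,v4), (θ∧ω)(v1,v3,v4), (θ∧ω)(v1,v2,v4), (θ∧ω)(v1,v2,v3))`. -/
theorem sign_five_cheap :
    ∃ (T : Finset (Fin 5)) (S : Fin 5 → Finset (Fin 5)) (u w : Fin 5 → (Fin 5 → Fin 5) → ℂ),
      (∀ t, ∀ v v' : Fin 5 → Fin 5, (∀ i ∈ S t, v i = v' i) → u t v = u t v') ∧
      (∀ t, ∀ v v' : Fin 5 → Fin 5, (∀ i, i ∉ S t → v i = v' i) → w t v = w t v') ∧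
      (∑ t ∈ T, (S t).card.factorial * (5 - (S t).card).factorial) = 72 ∧ 72 < Nat.factorial 5 ∧
      ∀ v : Fin 5 → Fin 5, (∑ t ∈ T, u t v * w t v)
        = ((((if v 0 < v 1 then (1:ℤ) else if v 1 < v 0 then (-1:ℤ) else 0) * (if v 0 < v 2 then (1:ℤ) else if v 2 < v 0 then (-1:ℤ) else 0) * (if v 0 < v 3 then (1:ℤ) else if v 3 < v 0 then (-1:ℤ) else 0) * (if v 0 < v 4 then (1:ℤ) else if v 4 < v 0 then (-1:ℤ) else 0) * (if v 1 < v 2 then (1:ℤ) else if v 2 < v 1 then (-1:ℤ) else 0) * (if v 1 < v 3 then (1:ℤ) else if v 3 < v 1 then (-1:ℤ) else 0) * (if v 1 < v 4 then (1:ℤ) else if v 4 < v 1 then (-1:ℤ) else 0) * (if v 2 < v 3 then (1:ℤ) else if v 3 < v 2 then (-1:ℤ) else 0) * (if v 2 < v 4 then (1:ℤ) else if v 4 < v 2 then (-1:ℤ) else 0) * (if v 3 < v 4 then (1:ℤ) else if v 4 < v 3 then (-1:ℤ) else 0)) : ℤ) : ℂ) := by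
  classical
  let S : Fin 5 → Finset (Fin 5) := ![{0}, {0, 1}, {0, 2}, {0, 3}, {0, 4}]
  let u : Fin 5 → (Fin 5 → Fin 5) → ℂ := ![fun v => (if v 0 = 4 then (1:ℂ) else 0),
    fun v => (if v 0 = 0 ∧ v 1 = 1 then (1:ℂ) else if v 0 = 1 ∧ v 1 = 0 then (-1:ℂ) else if v 0 = 2 ∧ v 1 = 3 then (1:ℂ) else if v 0 = 3 ∧ v 1 = 2 then (-1:ℂ) else 0),
    fun v => (-1:ℂ) * (if v 0 = 0 ∧ v 2 = 1 then (1:ℂ) else if v 0 = 1 ∧ v 2 = 0 then (-1:ℂ) else if v 0 = 2 ∧ v 2 = 3 then (1:ℂ) else if v 0 = 3 ∧ v 2 = 2 then (-1:ℂ) else 0),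
    fun v => (if v 0 = 0 ∧ v 3 = 1 then (1:ℂ) else if v 0 = 1 ∧ v 3 = 0 then (-1:ℂ) else if v 0 = 2 ∧ v 3 = 3 then (1:ℂ) else if v 0 = 3 ∧ v 3 = 2 then (-1:ℂ) else 0),
    fun v => (-1:ℂ) * (if v 0 = 0 ∧ v 4 = 1 then (1:ℂ) else if v 0 = 1 ∧ v 4 = 0 then (-1:ℂ) else if v 0 = 2 ∧ v 4 = 3 then (1:ℂ) else if v 0 = 3 ∧ v 4 = 2 then (-1:ℂ) else 0)]
  let w : Fin 5 → (Fin 5 → Fin 5) → ℂ := ![fun v => ((if v 1 = 0 ∧ v 2 = 1 then (1:ℂ) else if v 1 = 1 ∧ v 2 = 0 then (-1:ℂ) else if v 1 = 2 ∧ v 2 = 3 then (1:ℂ) else if v 1 = 3 ∧ v 2 = 2 then (-1:ℂ) else 0) * (if v 3 = 0 ∧ v 4 = 1 then (1:ℂ) else if v 3 = 1 ∧ v 4 = 0 then (-1:ℂ) else if v 3 = 2 ∧ v 4 = 3 then (1:ℂ) else if v 3 = 3 ∧ v 4 = 2 then (-1:ℂ) else 0) - (if v 1 = 0 ∧ v 3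 = 1 then (1:ℂ) else if v 1 = 1 ∧ v 3 = 0 then (-1:ℂ) else if v 1 = 2 ∧ v 3 = 3 then (1:ℂ) else if v 1 = 3 ∧ v 3 = 2 then (-1:ℂ) else 0) * (if v 2 = 0 ∧ v 4 = 1 then (1:ℂ) else if v 2 = 1 ∧ v 4 = 0 then (-1:ℂ) else if v 2 = 2 ∧ v 4 = 3 then (1:ℂ) else if v 2 = 3 ∧ v 4 = 2 then (-1:ℂ) else 0) + (if v 1 = 0 ∧ v 4 = 1 then (1:ℂ) else if v 1 = 1 ∧ v 4 = 0 then (-1:ℂ) else if v 1 = 2 ∧ v 4 = 3 then (1:ℂ) else if v 1 = 3 ∧ v 4 = 2 then (-1:ℂ) else 0) * (if v 2 = 0 ∧ v 3 = 1 then (1:ℂ) else if v 2 = 1 ∧ v 3 = 0 then (-1:ℂ) else if v 2 = 2 ∧ v 3 = 3 then (1:ℂ) else if v 2 = 3 ∧ v 3 = 2 then (-1:ℂ) else 0)),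
    fun v => ((if v 2 = 4 then (1:ℂ) else 0) * (if v 3 = 0 ∧ v 4 = 1 then (1:ℂ) else if v 3 = 1 ∧ v 4 = 0 then (-1:ℂ) else if v 3 = 2 ∧ v 4 = 3 then (1:ℂ) else if v 3 = 3 ∧ v 4 = 2 then (-1:ℂ) else 0) - (if v 3 = 4 then (1:ℂ) else 0) * (if v 2 = 0 ∧ v 4 = 1 then (1:ℂ) else if v 2 = 1 ∧ v 4 = 0 then (-1:ℂ) else if v 2 = 2 ∧ v 4 = 3 then (1:ℂ) else if v 2 = 3 ∧ v 4 = 2 then (-1:ℂ) else 0) + (if v 4 = 4 then (1:ℂ) else 0) * (if v 2 = 0 ∧ v 3 = 1 then (1:ℂ) else if v 2 = 1 ∧ v 3 = 0 then (-1:ℂ) else if v 2 = 2 ∧ v 3 = 3 then (1:ℂ) else if v 2 = 3 ∧ v 3 = 2 then (-1:ℂ) else 0)),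
    fun v => ((if v 1 = 4 then (1:ℂ) else 0) * (if v 3 = 0 ∧ v 4 = 1 then (1:ℂ) else if v 3 = 1 ∧ v 4 = 0 then (-1:ℂ) else if v 3 = 2 ∧ v 4 = 3 then (1:ℂ) else if v 3 = 3 ∧ v 4 = 2 then (-1:ℂ) else 0) - (if v 3 = 4 then (1:ℂ) else 0) * (if v 1 = 0 ∧ v 4 = 1 then (1:ℂ) else if v 1 = 1 ∧ v 4 = 0 then (-1:ℂ) else if v 1 = 2 ∧ v 4 = 3 then (1:ℂ) else if v 1 = 3 ∧ v 4 = 2 then (-1:ℂ) else 0) + (if v 4 = 4 then (1:ℂ) else 0) * (if v 1 = 0 ∧ v 3 = 1 then (1:ℂ) else if v 1 = 1 ∧ v 3 = 0 then (-1:ℂ) else if v 1 = 2 ∧ v 3 = 3 then (1:ℂ) else if v 1 = 3 ∧ v 3 = 2 then (-1:ℂ) else 0)),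
    fun v => ((if v 1 = 4 then (1:ℂ) else 0) * (if v 2 = 0 ∧ v 4 = 1 then (1:ℂ) else if v 2 = 1 ∧ v 4 = 0 then (-1:ℂ) else if v 2 = 2 ∧ v 4 = 3 then (1:ℂ) else if v 2 = 3 ∧ v 4 = 2 then (-1:ℂ) else 0) - (if v 2 = 4 then (1:ℂ) else 0) * (if v 1 = 0 ∧ v 4 = 1 then (1:ℂ) else if v 1 = 1 ∧ v 4 = 0 then (-1:ℂ) else if v 1 = 2 ∧ v 4 = 3 then (1:ℂ) else if v 1 = 3 ∧ v 4 = 2 then (-1:ℂ) else 0) + (if v 4 = 4 then (1:ℂ) else 0) * (if v 1 = 0 ∧ v 2 = 1 then (1:ℂ) else if v 1 = 1 ∧ v 2 = 0 then (-1:ℂ) else if v 1 = 2 ∧ v 2 = 3 then (1:ℂ) else if v 1 = 3 ∧ v 2 = 2 then (-1:ℂ) else 0)),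
    fun v => ((if v 1 = 4 then (1:ℂ) else 0) * (if v 2 = 0 ∧ v 3 = 1 then (1:ℂ) else if v 2 = 1 ∧ v 3 = 0 then (-1:ℂ) else if v 2 = 2 ∧ v 3 = 3 then (1:ℂ) else if v 2 = 3 ∧ v 3 = 2 then (-1:ℂ) else 0) - (if v 2 = 4 then (1:ℂ) else 0) * (if v 1 = 0 ∧ v 3 = 1 then (1:ℂ) else if v 1 = 1 ∧ v 3 = 0 then (-1:ℂ) else if v 1 = 2 ∧ v 3 = 3 then (1:ℂ) else if v 1 = 3 ∧ v 3 = 2 then (-1:ℂ) else 0) + (if v 3 = 4 then (1:ℂ) else 0) * (if v 1 = 0 ∧ v 2 = 1 then (1:ℂ) else if v 1 = 1 ∧ v 2 = 0 then (-1:ℂ) else if v 1 = 2 ∧ v 2 = 3 then (1:ℂ) else if v 1 = 3 ∧ v 2 = 2 then (-1:ℂ) else 0))]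
  refine ⟨Finset.univ, S, u, w, ?_, ?_, by decide, by decide, ?_⟩
  · intro t v v' h
    fin_cases t <;> simp only [u]
    · have h0 := h 0 (by simp [S]); simp [h0]
    · have h0 := h 0 (by simp [S]); have h1 := h 1 (by simp [S]); simp [h0, h1]
    · have h0 := h 0 (by simp [S]); have h1 := h 2 (by simp [S]); simp [h0, h1]
    · have h0 := h 0 (by simp [S]); have h1 := h 3 (by simp [S]); simp [h0, h1]
    · have h0 := h 0 (by simp [S]); have h1 := h 4 (by simp [S]); simp [h0, h1]
  · intro t v v' h
    fin_cases t <;> simp only [w]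
    · have h1 := h 1 (by simp [S]); have h2 := h 2 (by simp [S]); have h3 := h 3 (by simp [S]); have h4 := h 4 (by simp [S]); simp [h1, h2, h3, h4]
    · have h2 := h 2 (by simp [S]); have h3 := h 3 (by simp [S]); have h4 := h 4 (by simp [S]); simp [h2, h3, h4]
    · have h1 := h 1 (by simp [S]); have h3 := h 3 (by simp [S]); have h4 := h 4 (by simp [S]); simp [h1, h3, h4]
    · have h1 := h 1 (by simp [S]); have h2 := h 2 (by simp [S]); have h4 := h 4 (by simp [S]); simp [h1, h2, h4]
    · have h1 := h 1 (by simp [S]); have h2 := h 2 (by simp [S]); have h3 := h 3 (by simp [S]); simp [h1, h2, h3]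
  · intro v
    have hz := sign_five_hub_identity (v 0) (v 1) (v 2) (v 3) (v 4)
    have hc := congrArg (Int.cast : ℤ → ℂ) hz
    push_cast at hc
    simp only [Fin.sum_univ_succ, Fin.sum_univ_zero, u, w, Matrix.cons_val_zero, Matrix.cons_val_succ, add_zero]
    push_cast
    linear_combination -hc

/-- **The signed analogue of `LaplaceOptimalFive` is false** (written out with the Levi-Civita target inline, no new
definition): NOT every split-rank-one decomposition of `D₅` has Laplace weight `≥ 5!` — `sign_five_cheap` has weight `72`. -/
theorem not_signLaplaceOptimal_five :
    ¬ (∀ (N : ℕ) (T : Finset (Fin N)) (S : Fin N → Finset (Fin 5)) (u w : Fin N → (Fin 5 → Fin 5) → ℂ),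
        (∀ t, ∀ v v' : Fin 5 → Fin 5, (∀ i ∈ S t, v i = v' i) → u t v = u t v') →
        (∀ t, ∀ v v' : Fin 5 → Fin 5, (∀ i, i ∉ S t → v i = v' i) → w t v = w t v') →
        (∀ v : Fin 5 → Fin 5, (∑ t ∈ T, u t v * w t v)
          = ((((if v 0 < v 1 then (1:ℤ) else if v 1 < v 0 then (-1:ℤ) else 0) * (if v 0 < v 2 then (1:ℤ) else if v 2 < v 0 then (-1:ℤ) else 0) * (if v 0 < v 3 then (1:ℤ) else if v 3 < v 0 then (-1:ℤ) else 0) * (if v 0 < v 4 then (1:ℤ) else if v 4 < v 0 then (-1:ℤ) else 0) * (if v 1 < v 2 then (1:ℤ) else if v 2 < v 1 then (-1:ℤ) else 0) * (if v 1 < v 3 then (1:ℤ) else if v 3 < v 1 then (-1:ℤ) else 0) * (if v 1 < v 4 then (1:ℤ) else if v 4 < v 1 then (-1:ℤ) else 0) * (if v 2 < v 3 then (1:ℤ) else if v 3 < v 2 then (-1:ℤ) else 0) * (if v 2 < v 4 then (1:ℤ) else if v 4 < v 2 then (-1:ℤ) else 0) * (if v 3 < v 4 then (1:ℤ) else if v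 4 < v 3 then (-1:ℤ) else 0)) : ℤ) : ℂ)) →
        Nat.factorial 5 ≤ ∑ t ∈ T, (S t).card.factorial * (5 - (S t).card).factorial) := by
  intro hLO
  obtain ⟨T, S, u, w, hu, hw, hwt, hlt, hid⟩ := sign_five_cheap
  have h := hLO 5 T S u w hu hw hid
  rw [hwt] at h
  exact absurd (lt_of_lt_of_le hlt h) (lt_irrefl _)

set_option maxHeartbeats 40000000 in
/-- **A split decomposition of `D₄` of Laplace weight `12 < 24`**, in the data format of `LaplaceOptimal 4`:
`S = ({0,1}, {0,2}, {0,3})`, `u = (ω(v0,v1), -ω(v0,v2), ω(v0,v3))`, `w = (ω(v2,v3), ω(v1,v3), ω(v1,v2))`. -/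
theorem sign_four_cheap :
    ∃ (T : Finset (Fin 3)) (S : Fin 3 → Finset (Fin 4)) (u w : Fin 3 → (Fin 4 → Fin 4) → ℂ),
      (∀ t, ∀ v v' : Fin 4 → Fin 4, (∀ i ∈ S t, v i = v' i) → u t v = u t v') ∧
      (∀ t, ∀ v v' : Fin 4 → Fin 4, (∀ i, i ∉ S t → v i = v' i) → w t v = w t v') ∧
      (∑ t ∈ T, (S t).card.factorial * (4 - (S t).card).factorial) = 12 ∧ 12 < Nat.factorial 4 ∧
      ∀ v : Fin 4 → Fin 4, (∑ t ∈ T, u t v * w t v)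
        = ((((if v 0 < v 1 then (1:ℤ) else if v 1 < v 0 then (-1:ℤ) else 0) * (if v 0 < v 2 then (1:ℤ) else if v 2 < v 0 then (-1:ℤ) else 0) * (if v 0 < v 3 then (1:ℤ) else if v 3 < v 0 then (-1:ℤ) else 0) * (if v 1 < v 2 then (1:ℤ) else if v 2 < v 1 then (-1:ℤ) else 0) * (if v 1 < v 3 then (1:ℤ) else if v 3 < v 1 then (-1:ℤ) else 0) * (if v 2 < v 3 then (1:ℤ) else if v 3 < v 2 then (-1:ℤ) else 0)) : ℤ) : ℂ) := by
  classical
  let S : Fin 3 → Finset (Fin 4) := ![{0, 1}, {0, 2}, {0, 3}]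
  let u : Fin 3 → (Fin 4 → Fin 4) → ℂ := ![fun v => (if v 0 = 0 ∧ v 1 = 1 then (1:ℂ) else if v 0 = 1 ∧ v 1 = 0 then (-1:ℂ) else if v 0 = 2 ∧ v 1 = 3 then (1:ℂ) else if v 0 = 3 ∧ v 1 = 2 then (-1:ℂ) else 0),
    fun v => (-1:ℂ) * (if v 0 = 0 ∧ v 2 = 1 then (1:ℂ) else if v 0 = 1 ∧ v 2 = 0 then (-1:ℂ) else if v 0 = 2 ∧ v 2 = 3 then (1:ℂ) else if v 0 = 3 ∧ v 2 = 2 then (-1:ℂ) else 0),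
    fun v => (if v 0 = 0 ∧ v 3 = 1 then (1:ℂ) else if v 0 = 1 ∧ v 3 = 0 then (-1:ℂ) else if v 0 = 2 ∧ v 3 = 3 then (1:ℂ) else if v 0 = 3 ∧ v 3 = 2 then (-1:ℂ) else 0)]
  let w : Fin 3 → (Fin 4 → Fin 4) → ℂ := ![fun v => (if v 2 = 0 ∧ v 3 = 1 then (1:ℂ) else if v 2 = 1 ∧ v 3 = 0 then (-1:ℂ) else if v 2 = 2 ∧ v 3 = 3 then (1:ℂ) else if v 2 = 3 ∧ v 3 = 2 then (-1:ℂ) else 0),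
    fun v => (if v 1 = 0 ∧ v 3 = 1 then (1:ℂ) else if v 1 = 1 ∧ v 3 = 0 then (-1:ℂ) else if v 1 = 2 ∧ v 3 = 3 then (1:ℂ) else if v 1 = 3 ∧ v 3 = 2 then (-1:ℂ) else 0),
    fun v => (if v 1 = 0 ∧ v 2 = 1 then (1:ℂ) else if v 1 = 1 ∧ v 2 = 0 then (-1:ℂ) else if v 1 = 2 ∧ v 2 = 3 then (1:ℂ) else if v 1 = 3 ∧ v 2 = 2 then (-1:ℂ) else 0)]
  refine ⟨Finset.univ, S, u, w, ?_, ?_, by decide, by decide, ?_⟩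
  · intro t v v' h
    fin_cases t <;> simp only [u]
    · have h0 := h 0 (by simp [S]); have h1 := h 1 (by simp [S]); simp [h0, h1]
    · have h0 := h 0 (by simp [S]); have h1 := h 2 (by simp [S]); simp [h0, h1]
    · have h0 := h 0 (by simp [S]); have h1 := h 3 (by simp [S]); simp [h0, h1]
  · intro t v v' h
    fin_cases t <;> simp only [w]
    · have h2 := h 2 (by simp [S]); have h3 := h 3 (by simp [S]); simp [h2, h3]
    · have h1 := h 1 (by simp [S]); have h3 := h 3 (by simp [S]); simp [h1, h3]
    · have h1 := h 1 (by simp [S]); have h2 := h 2 (by simp [S]); simp [h1, h2]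
  · intro v
    have hz := sign_four_pfaffian (v 0) (v 1) (v 2) (v 3)
    have hc := congrArg (Int.cast : ℤ → ℂ) hz
    push_cast at hc
    simp only [Fin.sum_univ_succ, Fin.sum_univ_zero, u, w, Matrix.cons_val_zero, Matrix.cons_val_succ, add_zero]
    push_cast
    linear_combination -hc

end Summit.ValiantsHypothesis.ValiantsHypothesis.Theorems.LaplaceOptimalFiveNegative.SignPatternCheap
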